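import Mathlib
import HarnessLib

/-!
# `NoHeavyLowerTail` (stmt-CriticalPhenomena-4575) — (V_w) along an apex edge: variational form, chord identity, convex-criterion step

Support file (prover prim-ineq-gen-8 gen 41; `--supports stmt-CriticalPhenomena-4575`; memo
run/shared/lean/prim/prim-ineq-gen-8/FINDING-gen41-VW-CHORD.md §1).  No definitions, no named facts, no sorries; pure real algebra.

Context.  For bond percolation `μ = prodBernoulli w`, a glued apex set `S`, loads `ℓ ≥ 0`, `I_u = 1[S ~ u]`, `L = Σ_u ℓ_u I_u`,
`R` = sum of squared loads of the clusters not glued to `S`, gen 40 (memo FINDING-gen40-T3.md §0(5d)) conjectured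
(V_w): `W := Σ_u ℓ_u Cov(I_u,L)²/P(I_u) ≤ 2|Cov(L,R)|`, i.e. `T := W + 2 Cov(L,R) ≤ 0`, which implies (V) and, with the proved (P),
(Q0) and `E3 ≤ 0` for every direction on every finite graph.  Along the weight `z ∈ [0,1]` of an apex edge `e = st` the statistics are
affine mixtures of the two endpoint instances `(w∖e, S)` and `(w∖e, S∪{t})` (gen 40's endpoint identification) except that the
covariances pick up the explicit cross terms `N_u(z) = (1−z)N⁰_u + zN¹_u + z(1−z)δ_u d`, `C(z) = (1−z)C⁰ + zC¹ − z(1−z) d s`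
(`δ_u = p¹_u − p⁰_u`, `d = E D`, `s = E D²`, `D` = load of the cluster of `t` off `C(S)`).  This file records, as algebra over an arbitrary
finite index type, the three facts that organise the induction on the number of apex edges:
* `vw_variational_le` / `vw_variational_eq` — `W = sup_λ Σ_u ℓ_u(2λ_uN_u − λ_u²p_u)` (so `T = sup_λ [2Cov(L, L_λ+R) − E L_{λ²}]`);
* `vw_chord_term` — the exact per-vertex chord identity
  `(1−z)N⁰²/p⁰ + zN¹²/p¹ − N(z)²/p(z) = z(1−z)[p⁰p¹(N¹/p¹−N⁰/p⁰)² − 2dδ((1−z)N⁰+zN¹) − z(1−z)d²δ²]/p(z)`,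
  whose sum (plus `2z(1−z)ds` from the `2C` term) is the chord defect `(1−z)T(0)+zT(1)−T(z) = z(1−z)·C_S,t(z)` of the memo;
* `vw_step_of_convex` — if the optimal test function `λ* = N(z)/p(z)` satisfies the square-free criterion `Σ_u ℓ_uδ_uλ*_u ≤ s`
  then `T(z) ≤ (1−z)T(0) + zT(1)`; in particular `T ≤ 0` propagates from the two endpoints (`vw_step_nonpos_of_convex`),
  and `vw_step_nonpos_of_chord` is the same conclusion from non-negativity of the chord defect.
* `vw_cube_chord`, `vwPlus_step_nonpos_of_chord` — the same for the SHARP form (V_w⁺) `T + Σ_u ℓ_u³p_u(1−p_u²) ≤ 0` (equality on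
  every star; numerically tight), whose step needs the chord defect to dominate the bump `Σ_u ℓ_u³δ_u²(3p⁰_u + δ_u(1+z))`.
The remaining analytic input for (V_w) — that every instance has an apex edge meeting one of these two criteria — is numerically
robust but open (memo §2 (C1), (C6)).
[this work]
-/

noncomputable section

namespace Summit.CriticalPhenomena.PercolationContinuityZ3.Theorems

namespace APL

open Finset
open scoped BigOperators

/-! ### Variational form of `W = Σ ℓ N²/p` -/

/-- Pointwise variational bound: for `p > 0`, `2λN − λ²p ≤ N²/p` (complete the square). [folklore] -/
theorem vw_sq_div_ge (N p lam : ℝ) (hp : 0 < p) : 2 * lam * N - lam ^ 2 * p ≤ N ^ 2 / p := by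
  rw [le_div_iff₀ hp]
  nlinarith [sq_nonneg (N - lam * p)]

/-- Pointwise variational bound, attained at `λ = N/p`. [folklore] -/
theorem vw_sq_div_eq (N p : ℝ) (hp : 0 < p) : 2 * (N / p) * N - (N / p) ^ 2 * p = N ^ 2 / p := by
  field_simp
  ring

/-- **Variational lower bound.**  For weights `ℓ ≥ 0` and `p > 0`: `Σ_u ℓ_u(2λ_uN_u − λ_u²p_u) ≤ Σ_u ℓ_u N_u²/p_u` for every
test function `λ`.  (Percolation reading: `2Cov(L, L_λ) − E[L_{λ²}] ≤ W`.) [this work] -/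
theorem vw_variational_le {U : Type*} [Fintype U] (ℓ N p lam : U → ℝ)
    (hℓ : ∀ u, 0 ≤ ℓ u) (hp : ∀ u, 0 < p u) :
    ∑ u, ℓ u * (2 * lam u * N u - lam u ^ 2 * p u) ≤ ∑ u, ℓ u * (N u ^ 2 / p u) := by
  apply Finset.sum_le_sum
  intro u _
  exact mul_le_mul_of_nonneg_left (vw_sq_div_ge (N u) (p u) (lam u) (hp u)) (hℓ u)

/-- **Variational equality**: the bound `vw_variational_le` is attained at `λ_u = N_u/p_u`. [this work] -/
theorem vw_variational_eq {U : Type*} [Fintype U] (ℓ N p : U → ℝ) (hp : ∀ u, 0 < p u) :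
    ∑ u, ℓ u * (2 * (N u / p u) * N u - (N u / p u) ^ 2 * p u) = ∑ u, ℓ u * (N u ^ 2 / p u) := by
  apply Finset.sum_congr rfl
  intro u _
  rw [vw_sq_div_eq (N u) (p u) (hp u)]

/-! ### The chord identity along an apex edge -/

/-- **Per-vertex chord identity.**  With `δ = p¹ − p⁰`, `p(z) = (1−z)p⁰ + z p¹` and the mixed covariance
`N(z) = (1−z)N⁰ + zN¹ + z(1−z)δd`, the chord defect of `N²/p` is
`(1−z)N⁰²/p⁰ + zN¹²/p¹ − N(z)²/p(z) = z(1−z)·[p⁰p¹(N¹/p¹ − N⁰/p⁰)² − 2dδ((1−z)N⁰ + zN¹) − z(1−z)d²δ²]/p(z)`. [this work] -/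
theorem vw_chord_term (p0 p1 N0 N1 d z : ℝ) (hp0 : 0 < p0) (hp1 : 0 < p1) (hz0 : 0 ≤ z) (hz1 : z ≤ 1) :
    (1 - z) * (N0 ^ 2 / p0) + z * (N1 ^ 2 / p1)
        - ((1 - z) * N0 + z * N1 + z * (1 - z) * (p1 - p0) * d) ^ 2 / ((1 - z) * p0 + z * p1) =
      z * (1 - z) * ((p0 * p1 * (N1 / p1 - N0 / p0) ^ 2 - 2 * d * (p1 - p0) * ((1 - z) * N0 + z * N1)
        - z * (1 - z) * d ^ 2 * (p1 - p0) ^ 2) / ((1 - z) * p0 + z * p1)) := by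
  have hpz : 0 < (1 - z) * p0 + z * p1 := by
    rcases eq_or_lt_of_le hz1 with h | h
    · subst h; simpa using hp1
    · have : 0 < (1 - z) * p0 := mul_pos (by linarith) hp0
      have : 0 ≤ z * p1 := mul_nonneg hz0 hp1.le
      linarith
  have hp0' : p0 ≠ 0 := ne_of_gt hp0
  have hp1' : p1 ≠ 0 := ne_of_gt hp1
  have hpz' : (1 - z) * p0 + z * p1 ≠ 0 := ne_of_gt hpz
  field_simp
  ring

/-- The summed chord identity.  With `T(·) = Σ_u ℓ_u N_u(·)²/p_u(·) + 2C(·)` and `C(z) = (1−z)C⁰ + zC¹ − z(1−z)ds`: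
`(1−z)T⁰ + zT¹ − T(z) = z(1−z)·𝒞(z)`, `𝒞(z) = 2ds + Σ_u ℓ_u[p⁰p¹(N¹/p¹−N⁰/p⁰)² − 2dδ_u((1−z)N⁰_u+zN¹_u) − z(1−z)d²δ_u²]/p_u(z)`.
[this work] -/
theorem vw_chord_identity {U : Type*} [Fintype U] (ℓ p0 p1 N0 N1 : U → ℝ) (C0 C1 d s z : ℝ)
    (hp0 : ∀ u, 0 < p0 u) (hp1 : ∀ u, 0 < p1 u) (hz0 : 0 ≤ z) (hz1 : z ≤ 1) :
    (1 - z) * (∑ u, ℓ u * (N0 u ^ 2 / p0 u) + 2 * C0) + z * (∑ u, ℓ u * (N1 u ^ 2 / p1 u) + 2 * C1)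
        - (∑ u, ℓ u * (((1 - z) * N0 u + z * N1 u + z * (1 - z) * (p1 u - p0 u) * d) ^ 2 / ((1 - z) * p0 u + z * p1 u))
            + 2 * ((1 - z) * C0 + z * C1 - z * (1 - z) * d * s)) =
      z * (1 - z) * (2 * d * s + ∑ u, ℓ u * ((p0 u * p1 u * (N1 u / p1 u - N0 u / p0 u) ^ 2
        - 2 * d * (p1 u - p0 u) * ((1 - z) * N0 u + z * N1 u) - z * (1 - z) * d ^ 2 * (p1 u - p0 u) ^ 2)
          / ((1 - z) * p0 u + z * p1 u))) := by
  have key : ∀ u, (1 - z) * (ℓ u * (N0 u ^ 2 / p0 u)) + z * (ℓ u * (N1 u ^ 2 / p1 u))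
      - ℓ u * (((1 - z) * N0 u + z * N1 u + z * (1 - z) * (p1 u - p0 u) * d) ^ 2 / ((1 - z) * p0 u + z * p1 u)) =
      z * (1 - z) * (ℓ u * ((p0 u * p1 u * (N1 u / p1 u - N0 u / p0 u) ^ 2
        - 2 * d * (p1 u - p0 u) * ((1 - z) * N0 u + z * N1 u) - z * (1 - z) * d ^ 2 * (p1 u - p0 u) ^ 2)
          / ((1 - z) * p0 u + z * p1 u))) := by
    intro u
    have h := vw_chord_term (p0 u) (p1 u) (N0 u) (N1 u) d z (hp0 u) (hp1 u) hz0 hz1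
    have h' : ℓ u * ((1 - z) * (N0 u ^ 2 / p0 u) + z * (N1 u ^ 2 / p1 u)
        - ((1 - z) * N0 u + z * N1 u + z * (1 - z) * (p1 u - p0 u) * d) ^ 2 / ((1 - z) * p0 u + z * p1 u)) =
        ℓ u * (z * (1 - z) * ((p0 u * p1 u * (N1 u / p1 u - N0 u / p0 u) ^ 2
          - 2 * d * (p1 u - p0 u) * ((1 - z) * N0 u + z * N1 u) - z * (1 - z) * d ^ 2 * (p1 u - p0 u) ^ 2)
            / ((1 - z) * p0 u + z * p1 u))) := by rw [h]
    have e1 : (1 - z) * (ℓ u * (N0 u ^ 2 / p0 u)) + z * (ℓ u * (N1 u ^ 2 / p1 u))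
        - ℓ u * (((1 - z) * N0 u + z * N1 u + z * (1 - z) * (p1 u - p0 u) * d) ^ 2 / ((1 - z) * p0 u + z * p1 u)) =
        ℓ u * ((1 - z) * (N0 u ^ 2 / p0 u) + z * (N1 u ^ 2 / p1 u)
        - ((1 - z) * N0 u + z * N1 u + z * (1 - z) * (p1 u - p0 u) * d) ^ 2 / ((1 - z) * p0 u + z * p1 u)) := by ring
    rw [e1, h']
    ring
  have hs : ∑ u, ((1 - z) * (ℓ u * (N0 u ^ 2 / p0 u)) + z * (ℓ u * (N1 u ^ 2 / p1 u))
      - ℓ u * (((1 - z) * N0 u + z * N1 u + z * (1 - z) * (p1 u - p0 u) * d) ^ 2 / ((1 - z) * p0 u + z * p1 u))) =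
      ∑ u, z * (1 - z) * (ℓ u * ((p0 u * p1 u * (N1 u / p1 u - N0 u / p0 u) ^ 2
        - 2 * d * (p1 u - p0 u) * ((1 - z) * N0 u + z * N1 u) - z * (1 - z) * d ^ 2 * (p1 u - p0 u) ^ 2)
          / ((1 - z) * p0 u + z * p1 u))) := Finset.sum_congr rfl (fun u _ => key u)
  rw [Finset.sum_sub_distrib, Finset.sum_add_distrib, ← Finset.mul_sum, ← Finset.mul_sum, ← Finset.mul_sum] at hs
  linear_combination hs

/-! ### The induction step under the convexity criterion / under the chord criterion -/

/-- **Step under the square-free (convexity) criterion.**  Endpoint data `p⁰, p¹ > 0`, `N⁰, N¹`, `C⁰, C¹`, increments `d ≥ 0`, `s`,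
weights `ℓ ≥ 0`, `z ∈ [0,1]`; mixed statistics `p(z), N(z), C(z)` as above and `λ*_u = N_u(z)/p_u(z)`.  If
`d·Σ_u ℓ_u(p¹_u−p⁰_u)λ*_u ≤ d·s` (in percolation: the `Δ(z)`-load of the t-cluster is at most its second moment, which makes
`F_{λ*}` convex in the edge weight), then `T(z) ≤ (1−z)T⁰ + zT¹`. [this work] -/
theorem vw_step_of_convex {U : Type*} [Fintype U] (ℓ p0 p1 N0 N1 : U → ℝ) (C0 C1 d s z : ℝ)
    (hℓ : ∀ u, 0 ≤ ℓ u) (hp0 : ∀ u, 0 < p0 u) (hp1 : ∀ u, 0 < p1 u) (hz0 : 0 ≤ z) (hz1 : z ≤ 1)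
    (hcrit : d * ∑ u, ℓ u * ((p1 u - p0 u) *
        (((1 - z) * N0 u + z * N1 u + z * (1 - z) * (p1 u - p0 u) * d) / ((1 - z) * p0 u + z * p1 u))) ≤ d * s) :
    (∑ u, ℓ u * (((1 - z) * N0 u + z * N1 u + z * (1 - z) * (p1 u - p0 u) * d) ^ 2 / ((1 - z) * p0 u + z * p1 u))
        + 2 * ((1 - z) * C0 + z * C1 - z * (1 - z) * d * s)) ≤
      (1 - z) * (∑ u, ℓ u * (N0 u ^ 2 / p0 u) + 2 * C0) + z * (∑ u, ℓ u * (N1 u ^ 2 / p1 u) + 2 * C1) := by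
  -- abbreviations
  set pz : U → ℝ := fun u => (1 - z) * p0 u + z * p1 u with hpz_def
  set Nz : U → ℝ := fun u => (1 - z) * N0 u + z * N1 u + z * (1 - z) * (p1 u - p0 u) * d with hNz_def
  set lam : U → ℝ := fun u => Nz u / pz u with hlam_def
  have hpz : ∀ u, 0 < pz u := by
    intro u
    rcases eq_or_lt_of_le hz1 with h | h
    · simp only [hpz_def, h]; simpa using hp1 u
    · have : 0 < (1 - z) * p0 u := mul_pos (by linarith) (hp0 u)
      have : 0 ≤ z * p1 u := mul_nonneg hz0 (hp1 u).le
      simp only [hpz_def]; linarith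
  -- T(z) equals the value of the quadratic functional at λ* = N(z)/p(z)
  have hW : ∑ u, ℓ u * (Nz u ^ 2 / pz u) = ∑ u, ℓ u * (2 * lam u * Nz u - lam u ^ 2 * pz u) := by
    rw [vw_variational_eq ℓ Nz pz hpz]
  -- the quadratic functional at fixed λ decomposes affinely plus the cross term
  have hdec : ∑ u, ℓ u * (2 * lam u * Nz u - lam u ^ 2 * pz u) =
      (1 - z) * ∑ u, ℓ u * (2 * lam u * N0 u - lam u ^ 2 * p0 u)
        + z * ∑ u, ℓ u * (2 * lam u * N1 u - lam u ^ 2 * p1 u)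
        + 2 * z * (1 - z) * d * ∑ u, ℓ u * ((p1 u - p0 u) * lam u) := by
    rw [Finset.mul_sum, Finset.mul_sum, Finset.mul_sum, ← Finset.sum_add_distrib, ← Finset.sum_add_distrib]
    apply Finset.sum_congr rfl
    intro u _
    simp only [hNz_def, hpz_def]
    ring
  -- endpoint bounds from the variational inequality
  have h0 : ∑ u, ℓ u * (2 * lam u * N0 u - lam u ^ 2 * p0 u) ≤ ∑ u, ℓ u * (N0 u ^ 2 / p0 u) :=
    vw_variational_le ℓ N0 p0 lam hℓ hp0
  have h1 : ∑ u, ℓ u * (2 * lam u * N1 u - lam u ^ 2 * p1 u) ≤ ∑ u, ℓ u * (N1 u ^ 2 / p1 u) :=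
    vw_variational_le ℓ N1 p1 lam hℓ hp1
  have hzz : 0 ≤ z * (1 - z) := mul_nonneg hz0 (by linarith)
  have hcrit' : d * ∑ u, ℓ u * ((p1 u - p0 u) * lam u) ≤ d * s := by
    simpa [hlam_def, hNz_def, hpz_def] using hcrit
  have hcross : 2 * z * (1 - z) * d * ∑ u, ℓ u * ((p1 u - p0 u) * lam u) ≤ 2 * z * (1 - z) * d * s := by
    have := mul_le_mul_of_nonneg_left hcrit' (mul_nonneg (by norm_num : (0:ℝ) ≤ 2) hzz)
    linarith [this]
  have m0 := mul_le_mul_of_nonneg_left h0 (by linarith : 0 ≤ 1 - z)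
  have m1 := mul_le_mul_of_nonneg_left h1 hz0
  -- assemble
  have hTz : (∑ u, ℓ u * (Nz u ^ 2 / pz u)) + 2 * ((1 - z) * C0 + z * C1 - z * (1 - z) * d * s) ≤
      (1 - z) * (∑ u, ℓ u * (N0 u ^ 2 / p0 u) + 2 * C0) + z * (∑ u, ℓ u * (N1 u ^ 2 / p1 u) + 2 * C1) := by
    rw [hW, hdec]
    nlinarith [m0, m1, hcross]
  simpa [hNz_def, hpz_def] using hTz

/-- **(V_w) propagates along an apex edge under the convexity criterion**: with the hypotheses of `vw_step_of_convex`, if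
`T⁰ ≤ 0` and `T¹ ≤ 0` then `T(z) ≤ 0`. [this work] -/
theorem vw_step_nonpos_of_convex {U : Type*} [Fintype U] (ℓ p0 p1 N0 N1 : U → ℝ) (C0 C1 d s z : ℝ)
    (hℓ : ∀ u, 0 ≤ ℓ u) (hp0 : ∀ u, 0 < p0 u) (hp1 : ∀ u, 0 < p1 u) (hz0 : 0 ≤ z) (hz1 : z ≤ 1)
    (hcrit : d * ∑ u, ℓ u * ((p1 u - p0 u) *
        (((1 - z) * N0 u + z * N1 u + z * (1 - z) * (p1 u - p0 u) * d) / ((1 - z) * p0 u + z * p1 u))) ≤ d * s)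
    (hT0 : ∑ u, ℓ u * (N0 u ^ 2 / p0 u) + 2 * C0 ≤ 0) (hT1 : ∑ u, ℓ u * (N1 u ^ 2 / p1 u) + 2 * C1 ≤ 0) :
    (∑ u, ℓ u * (((1 - z) * N0 u + z * N1 u + z * (1 - z) * (p1 u - p0 u) * d) ^ 2 / ((1 - z) * p0 u + z * p1 u))
        + 2 * ((1 - z) * C0 + z * C1 - z * (1 - z) * d * s)) ≤ 0 := by
  have h := vw_step_of_convex ℓ p0 p1 N0 N1 C0 C1 d s z hℓ hp0 hp1 hz0 hz1 hcrit
  have m0 : (1 - z) * (∑ u, ℓ u * (N0 u ^ 2 / p0 u) + 2 * C0) ≤ 0 := mul_nonpos_of_nonneg_of_nonpos (by linarith) hT0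
  have m1 : z * (∑ u, ℓ u * (N1 u ^ 2 / p1 u) + 2 * C1) ≤ 0 := mul_nonpos_of_nonneg_of_nonpos hz0 hT1
  linarith

/-- **(V_w) propagates along an apex edge under the chord criterion**: if the chord defect
`𝒞(z) = 2ds + Σ_u ℓ_u[p⁰p¹(N¹/p¹−N⁰/p⁰)² − 2dδ_u((1−z)N⁰_u+zN¹_u) − z(1−z)d²δ_u²]/p_u(z)` is non-negative and `T⁰, T¹ ≤ 0`,
then `T(z) ≤ 0`. [this work] -/
theorem vw_step_nonpos_of_chord {U : Type*} [Fintype U] (ℓ p0 p1 N0 N1 : U → ℝ) (C0 C1 d s z : ℝ)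
    (hp0 : ∀ u, 0 < p0 u) (hp1 : ∀ u, 0 < p1 u) (hz0 : 0 ≤ z) (hz1 : z ≤ 1)
    (hchord : 0 ≤ 2 * d * s + ∑ u, ℓ u * ((p0 u * p1 u * (N1 u / p1 u - N0 u / p0 u) ^ 2
        - 2 * d * (p1 u - p0 u) * ((1 - z) * N0 u + z * N1 u) - z * (1 - z) * d ^ 2 * (p1 u - p0 u) ^ 2)
          / ((1 - z) * p0 u + z * p1 u)))
    (hT0 : ∑ u, ℓ u * (N0 u ^ 2 / p0 u) + 2 * C0 ≤ 0) (hT1 : ∑ u, ℓ u * (N1 u ^ 2 / p1 u) + 2 * C1 ≤ 0) :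
    (∑ u, ℓ u * (((1 - z) * N0 u + z * N1 u + z * (1 - z) * (p1 u - p0 u) * d) ^ 2 / ((1 - z) * p0 u + z * p1 u))
        + 2 * ((1 - z) * C0 + z * C1 - z * (1 - z) * d * s)) ≤ 0 := by
  have hid := vw_chord_identity ℓ p0 p1 N0 N1 C0 C1 d s z hp0 hp1 hz0 hz1
  have hzz : 0 ≤ z * (1 - z) := mul_nonneg hz0 (by linarith)
  have hpos := mul_nonneg hzz hchord
  have m0 : (1 - z) * (∑ u, ℓ u * (N0 u ^ 2 / p0 u) + 2 * C0) ≤ 0 := mul_nonpos_of_nonneg_of_nonpos (by linarith) hT0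
  have m1 : z * (∑ u, ℓ u * (N1 u ^ 2 / p1 u) + 2 * C1) ≤ 0 := mul_nonpos_of_nonneg_of_nonpos hz0 hT1
  linarith


/-! ### The sharp form (V_w⁺): `T + Σ_u ℓ_u³ p_u(1 − p_u²) ≤ 0` (equality on stars) -/

/-- Chord bump of the concave cubic `p ↦ p − p³` along an affine path `p(z) = (1−z)p⁰ + z p¹`, `δ = p¹ − p⁰`:
`p(z) − p(z)³ − [(1−z)(p⁰ − p⁰³) + z(p¹ − p¹³)] = z(1−z)·δ²·(3p⁰ + δ(1+z))`. [folklore] -/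
theorem vw_cube_chord (p0 p1 z : ℝ) :
    ((1 - z) * p0 + z * p1) - ((1 - z) * p0 + z * p1) ^ 3 - ((1 - z) * (p0 - p0 ^ 3) + z * (p1 - p1 ^ 3)) =
      z * (1 - z) * ((p1 - p0) ^ 2 * (3 * p0 + (p1 - p0) * (1 + z))) := by
  ring

/-- **Step for the sharp form (V_w⁺) under the strengthened chord criterion.**  With `Φ(·) = Σ_u ℓ_u³ p_u(·)(1 − p_u(·)²)` and
`T⁺ = T + Φ` (the conjectured sharp inequality `T⁺ ≤ 0`, an equality on every star): if the chord defect `𝒞(z)` of `T` dominates the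
chord bump of `Φ`, i.e. `𝒞(z) ≥ Σ_u ℓ_u³ δ_u²(3p⁰_u + δ_u(1+z))`, and `T⁺ ≤ 0` at both endpoints, then `T⁺(z) ≤ 0`. [this work] -/
theorem vwPlus_step_nonpos_of_chord {U : Type*} [Fintype U] (ℓ p0 p1 N0 N1 : U → ℝ) (C0 C1 d s z : ℝ)
    (hp0 : ∀ u, 0 < p0 u) (hp1 : ∀ u, 0 < p1 u) (hz0 : 0 ≤ z) (hz1 : z ≤ 1)
    (hchord : ∑ u, ℓ u ^ 3 * ((p1 u - p0 u) ^ 2 * (3 * p0 u + (p1 u - p0 u) * (1 + z))) ≤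
      2 * d * s + ∑ u, ℓ u * ((p0 u * p1 u * (N1 u / p1 u - N0 u / p0 u) ^ 2
        - 2 * d * (p1 u - p0 u) * ((1 - z) * N0 u + z * N1 u) - z * (1 - z) * d ^ 2 * (p1 u - p0 u) ^ 2)
          / ((1 - z) * p0 u + z * p1 u)))
    (hT0 : ∑ u, ℓ u * (N0 u ^ 2 / p0 u) + 2 * C0 + ∑ u, ℓ u ^ 3 * (p0 u - p0 u ^ 3) ≤ 0)
    (hT1 : ∑ u, ℓ u * (N1 u ^ 2 / p1 u) + 2 * C1 + ∑ u, ℓ u ^ 3 * (p1 u - p1 u ^ 3) ≤ 0) :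
    (∑ u, ℓ u * (((1 - z) * N0 u + z * N1 u + z * (1 - z) * (p1 u - p0 u) * d) ^ 2 / ((1 - z) * p0 u + z * p1 u))
        + 2 * ((1 - z) * C0 + z * C1 - z * (1 - z) * d * s))
      + ∑ u, ℓ u ^ 3 * (((1 - z) * p0 u + z * p1 u) - ((1 - z) * p0 u + z * p1 u) ^ 3) ≤ 0 := by
  have hid := vw_chord_identity ℓ p0 p1 N0 N1 C0 C1 d s z hp0 hp1 hz0 hz1
  -- chord bump of Φ, summed
  have hΦ : ∑ u, ℓ u ^ 3 * (((1 - z) * p0 u + z * p1 u) - ((1 - z) * p0 u + z * p1 u) ^ 3)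
      - ((1 - z) * ∑ u, ℓ u ^ 3 * (p0 u - p0 u ^ 3) + z * ∑ u, ℓ u ^ 3 * (p1 u - p1 u ^ 3)) =
      z * (1 - z) * ∑ u, ℓ u ^ 3 * ((p1 u - p0 u) ^ 2 * (3 * p0 u + (p1 u - p0 u) * (1 + z))) := by
    have key : ∀ u, ℓ u ^ 3 * (((1 - z) * p0 u + z * p1 u) - ((1 - z) * p0 u + z * p1 u) ^ 3)
        - ((1 - z) * (ℓ u ^ 3 * (p0 u - p0 u ^ 3)) + z * (ℓ u ^ 3 * (p1 u - p1 u ^ 3))) =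
        z * (1 - z) * (ℓ u ^ 3 * ((p1 u - p0 u) ^ 2 * (3 * p0 u + (p1 u - p0 u) * (1 + z)))) := by
      intro u
      have h := vw_cube_chord (p0 u) (p1 u) z
      linear_combination (ℓ u ^ 3) * h
    have hs := Finset.sum_congr rfl (fun u (_ : u ∈ (Finset.univ : Finset U)) => key u)
    rw [Finset.sum_sub_distrib, Finset.sum_add_distrib, ← Finset.mul_sum, ← Finset.mul_sum, ← Finset.mul_sum] at hs
    linear_combination hs
  have hzz : 0 ≤ z * (1 - z) := mul_nonneg hz0 (by linarith)
  have hgap : 0 ≤ z * (1 - z) * (2 * d * s + ∑ u, ℓ u * ((p0 u * p1 u * (N1 u / p1 u - N0 u / p0 u) ^ 2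
        - 2 * d * (p1 u - p0 u) * ((1 - z) * N0 u + z * N1 u) - z * (1 - z) * d ^ 2 * (p1 u - p0 u) ^ 2)
          / ((1 - z) * p0 u + z * p1 u))
      - ∑ u, ℓ u ^ 3 * ((p1 u - p0 u) ^ 2 * (3 * p0 u + (p1 u - p0 u) * (1 + z)))) :=
    mul_nonneg hzz (by linarith)
  have m0 : (1 - z) * (∑ u, ℓ u * (N0 u ^ 2 / p0 u) + 2 * C0 + ∑ u, ℓ u ^ 3 * (p0 u - p0 u ^ 3)) ≤ 0 :=
    mul_nonpos_of_nonneg_of_nonpos (by linarith) hT0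
  have m1 : z * (∑ u, ℓ u * (N1 u ^ 2 / p1 u) + 2 * C1 + ∑ u, ℓ u ^ 3 * (p1 u - p1 u ^ 3)) ≤ 0 :=
    mul_nonpos_of_nonneg_of_nonpos hz0 hT1
  nlinarith [hid, hΦ, hgap, m0, m1]

end APL

end Summit.CriticalPhenomena.PercolationContinuityZ3.Theorems

end
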